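import Literature.NumberTheory.QuadraticFields.IdealLatticeWeightedSum
import Literature.NumberTheory.QuadraticFields.IdealsOfPrimePowerNorm
import Literature.NumberTheory.QuadraticFields.FormIdealsStructure
import Literature.NumberTheory.LFunctions.ClassGroupCharacterTwist
import HarnessLib

/-!
# The sublattice `𝔰·𝔟` of a form ideal cut out by a ramified ideal `𝔰` (`𝔰² = (s)`, `s ∣ d_K`):
# `xC + y(ω − k) ∈ 𝔰·(C, ω − k) ⟺ s ∣ 2Cx − By ∧ s ∣ 2Ay − Bx`, and the class sums it carries

Topic `NumberTheory/QuadraticFields`, namespace `Literature.NumberTheory.QuadraticFields.Quadratic`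
(continuing `FormIdeals.lean`, `IdealsOfPrimePowerNorm.lean`, `IdealLatticeWeightedSum.lean`).
Everything here is PROVED (theorems only, no definitions, no named facts).

Setting: a quadratic ring of integers with `ℤ`-basis `(1, ω)`, `ω² = m + tω` (`d_K = t² + 4m`);
a pair of form ideals `𝔟_A = (A, ω − k)`, `𝔟_C = (C, ω − k)` with `AC = k² − tk − m = N(ω − k)`
(the forms `(A, B, C)` and `(C, B, A)`, `B = 2k − t`, of discriminant `d_K`); and, for an ODD
`s` and `k₁, C₁` with `s ∣ 2k₁ − t`, `sC₁ = k₁² − tk₁ − m`, `gcd(s, C₁) = 1`, the ideal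
`𝔰 = (s, ω − k₁)` — for squarefree `d_K` and `s ∣ d_K` this is THE ideal of norm `s`, the product
of the ramified primes over `s`, `𝔰 = (s, √d_K)`. We prove:

* `genusIdeal_mul_self` — **`𝔰² = (s)`** (`𝔰` equals its conjugate; an ideal times its conjugate is
  its norm, `span_pair_mul_span_pair_conj`);
* `formIdeal_mul_formIdeal_swap` — **`𝔟_A 𝔟_C = (ω − k)`** for a primitive form (so
  `[𝔟_C] = [𝔟_A]⁻¹`);
* `mem_genusIdeal_mul_formIdeal_iff` — **the index-`s` sublattice**: for integers `x, y`,
  `xC + y(ω − k) ∈ 𝔰𝔟_C ⟺ s ∣ 2Cx − By ∧ s ∣ 2Ay − Bx` (`B = 2k − t`), i.e. in the coordinates of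
  `𝔟_C ≅ ℤ²` the sublattice `𝔰𝔟_C` is `L_s = {v ∈ ℤ² : M̃v ≡ 0 (mod s)}` with `M̃ = (2C −B; −B 2A)`
  the Hessian of the form `Q̃ = (C, −B, A)` — the lattice over which the Poisson-dual of a congruent
  binary theta series at a cusp of denominator `c`, `(c, d_K) = s`, is supported
  (`Literature.NumberTheory.Automorphic.BinaryThetaPeriodicWeight`). Proof: `α ∈ 𝔰𝔟 ⟺ 𝔰α ⊆ 𝔰²𝔟 = s𝔟
  ⟺ (ω − k₁)α ∈ s𝔟`, and `(ω − k₁)(xC + y(ω − k)) = (x(k − k₁) − yA)·C + (xC + y(t − k − k₁))·(ω − k)`,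
  whose coordinates are `≡ 0 (mod s)` iff (multiplying by `2`, `s` odd, `2k₁ ≡ t`)
  `Bx − 2Ay ≡ 0` and `2Cx − By ≡ 0`;
* `absNorm_genusIdeal_mul_formIdeal` — `N(𝔰𝔟_C) = s·C`, and `norm_formLattice_elt'` —
  `N(xC + y(ω − k)) = C·Q̃(x,y)`, so that on `L_s`, `Q̃(x,y)/s = N(α)/N(𝔰𝔟_C)`.

With `hasSum_ideal_mul_isPrincipal_weight_of_ideal` this turns the `L_s`-theta series
`Σ_{v ∈ L_s} F(Q̃(v)/s)` into twice the class sum of `[𝔰𝔟_C]⁻¹ = [𝔰][𝔟_A]` — the "reassembly over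
`Cl(K)`" step of the transformation law of class-group theta series at the cusps `a/c`
(Conrey–Iwaniec 2002, §3 (3.14)–(3.18): `ψ ↦ ψψ_s`). References: [Cox2013] D. A. Cox, *Primes of the
form x² + ny²*, 2nd ed. (2013), §7.B Thm. 7.7, (7.12); [ConreyIwaniec2002] B. Conrey, H. Iwaniec,
Acta Arith. 103 (2002) 259–312, §3 (3.16)–(3.18).
-/

noncomputable section

open Module NumberField Ideal

namespace Literature.NumberTheory.QuadraticFields.Quadratic

variable {K : Type*} [Field K] [NumberField K] (b : Basis (Fin 2) ℤ (𝓞 K)) (hb : b 0 = 1)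
  {t m : ℤ} (hω : b 1 * b 1 = (m : 𝓞 K) + (t : 𝓞 K) * b 1)

/-! ### The ramified ideal `𝔰 = (s, ω − k₁)`: `𝔰² = (s)` -/

include hω in
/-- **`𝔰² = (s)`** for `𝔰 = (s, ω − k₁)` with `s ∣ 2k₁ − t`, `sC₁ = k₁² − tk₁ − m`,
`gcd(s, C₁) = 1`: the conjugate `(s, ω − (t − k₁))` is `𝔰` itself (`s ∣ k₁ − (t − k₁)`), and an
ideal times its conjugate is its norm (`span_pair_mul_span_pair_conj`; primitivity of
`(s, 2k₁ − t, C₁)` from `gcd(s, C₁) = 1`). For `s ∣ d_K` squarefree this is the square of the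
product of the ramified primes over `s`. [cite: Cox2013, §7.B Thm. 7.7] -/
theorem genusIdeal_mul_self {s k₁ C₁ : ℤ} (hk₁ : s ∣ 2 * k₁ - t)
    (hC₁ : s * C₁ = k₁ ^ 2 - t * k₁ - m) (hcop : IsCoprime s C₁) :
    span {(s : 𝓞 K), b 1 - k₁} * span {(s : 𝓞 K), b 1 - k₁} = span {(s : 𝓞 K)} := by
  have hconj : span {(s : 𝓞 K), b 1 - ((t - k₁ : ℤ) : 𝓞 K)} = span {(s : 𝓞 K), b 1 - k₁} := by
    refine span_pair_eq_span_pair_of_dvd_sub (b 1) ?_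
    have : t - k₁ - k₁ = -(2 * k₁ - t) := by ring
    rw [this]
    exact (dvd_neg).mpr hk₁
  have hprim : ∀ d : ℤ, d ∣ s → d ∣ 2 * k₁ - t → d ∣ C₁ → IsUnit d :=
    fun d hd _ hdC => hcop.isUnit_of_dvd' hd hdC
  have h := span_pair_mul_span_pair_conj b hω hC₁ hprim
  rwa [hconj] at h

/-! ### `𝔟_A · 𝔟_C = (ω − k)` -/

include hω in
/-- **`(A, ω − k)·(C, ω − k) = (ω − k)`** when `AC = k² − tk − m` (`= N(ω − k)`) and the form
`(A, 2k − t, C)` is primitive: all four products of generators are multiples of `ω − k`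
(`AC = −(ω − k)(ω − (t − k))`), and `uA + v(2k − t) + wC = 1` exhibits `ω − k` in the product
(`(2k − t)(ω − k) = AC·… `: `(t − 2k)(ω − k) = (ω − k)² + AC`). Hence `[𝔟_C] = [𝔟_A]⁻¹` — the ideal
classes of the forms `(A, B, C)` and `(C, B, A)` are inverse (Cox (7.12): composition with the
opposite form). [cite: Cox2013, §7.B Thm. 7.7, (7.12)] -/
theorem formIdeal_mul_formIdeal_swap {A k C : ℤ} (hn : A * C = k ^ 2 - t * k - m)
    (hprim : ∃ u v w : ℤ, u * A + v * (2 * k - t) + w * C = 1) :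
    span {(A : 𝓞 K), b 1 - k} * span {(C : 𝓞 K), b 1 - k} = span {b 1 - (k : 𝓞 K)} := by
  have hconj := sub_mul_sub_conj_eq b hω k
  -- `(ω − k)(ω − (t − k)) = −AC`
  have hAC : (b 1 - k) * (b 1 - ((t - k : ℤ) : 𝓞 K)) = -((A : 𝓞 K) * C) := by
    rw [hconj, ← hn]; push_cast; ring
  rw [span_pair_mul_span_pair]
  refine le_antisymm ?_ ?_
  · rw [span_le]
    rintro x hx
    simp only [Set.mem_insert_iff, Set.mem_singleton_iff] at hx
    rw [SetLike.mem_coe, mem_span_singleton']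
    rcases hx with rfl | rfl | rfl | rfl
    · refine ⟨-(b 1 - ((t - k : ℤ) : 𝓞 K)), ?_⟩
      linear_combination -hAC
    · exact ⟨(A : 𝓞 K), by ring⟩
    · exact ⟨(C : 𝓞 K), by ring⟩
    · exact ⟨b 1 - k, by ring⟩
  · obtain ⟨u, v, w, huvw⟩ := hprim
    set I : Ideal (𝓞 K) := span {(A : 𝓞 K) * C, (A : 𝓞 K) * (b 1 - k), (b 1 - k) * C,
      (b 1 - k) * (b 1 - k)} with hI
    have h2 : (A : 𝓞 K) * (b 1 - k) ∈ I := subset_span (by simp)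
    have h3 : (b 1 - k) * (C : 𝓞 K) ∈ I := subset_span (by simp)
    have h1 : (A : 𝓞 K) * C ∈ I := subset_span (by simp)
    have h4 : (b 1 - k) * (b 1 - k) ∈ I := subset_span (by simp)
    -- `(2k − t)(ω − k) = −(ω − k)² − AC`
    have hB : ((2 * k - t : ℤ) : 𝓞 K) * (b 1 - k) ∈ I := by
      have : ((2 * k - t : ℤ) : 𝓞 K) * (b 1 - k) = -((b 1 - k) * (b 1 - k)) - (A : 𝓞 K) * C := by
        have e : ((2 * k - t : ℤ) : 𝓞 K) = (b 1 - ((t - k : ℤ) : 𝓞 K)) - (b 1 - k) := by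
          push_cast; ring
        rw [e]
        linear_combination hAC
      rw [this]
      exact I.sub_mem (I.neg_mem h4) h1
    have hmem : (b 1 - (k : 𝓞 K)) ∈ I := by
      have e : (b 1 - (k : 𝓞 K)) = ((u : ℤ) : 𝓞 K) * ((A : 𝓞 K) * (b 1 - k)) +
          ((v : ℤ) : 𝓞 K) * (((2 * k - t : ℤ) : 𝓞 K) * (b 1 - k)) +
            ((w : ℤ) : 𝓞 K) * ((b 1 - k) * (C : 𝓞 K)) := by
        have := congrArg (fun z : ℤ => ((z : ℤ) : 𝓞 K) * (b 1 - k)) huvw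
        push_cast at this ⊢
        linear_combination -this
      rw [e]
      exact I.add_mem (I.add_mem (I.mul_mem_left _ h2) (I.mul_mem_left _ hB))
        (I.mul_mem_left _ h3)
    exact (span_singleton_le_iff_mem _).2 hmem

/-! ### The norm form on `𝔟_C = (C, ω − k)` and the norm of `𝔰𝔟_C` -/

omit [NumberField K] in
include hb hω in
/-- `N(xC + y(ω − k)) = C·(Cx² + (t − 2k)xy + Ay²)` when `AC = k² − tk − m` (the norm form of
`(C, ω − k)` is the form `(C, t − 2k, A)`; `norm_lattice_elt` with the roles of `A` and `C`
exchanged). [cite: Cox2013, §7.B Thm. 7.7] -/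
theorem norm_formLattice_elt_swap {A k C : ℤ} (hn : A * C = k ^ 2 - t * k - m) (x y : ℤ) :
    Algebra.norm ℤ ((x : 𝓞 K) * C + (y : 𝓞 K) * (b 1 - k)) =
      C * (C * x ^ 2 + (t - 2 * k) * x * y + A * y ^ 2) :=
  norm_lattice_elt b hb hω (A := C) (C := A) (by rw [← hn]; ring) x y

include hb hω in
/-- **`N(𝔰·𝔟_C) = |s|·|C|`** (`N𝔰 = |s|`, `N(C, ω − k) = |C|`, multiplicativity).
[cite: Cox2013, §7.B Thm. 7.7] -/
theorem absNorm_genusIdeal_mul_formIdeal {s k₁ C₁ A k C : ℤ}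
    (hC₁ : s * C₁ = k₁ ^ 2 - t * k₁ - m) (hn : A * C = k ^ 2 - t * k - m) :
    absNorm (span {(s : 𝓞 K), b 1 - k₁} * span {(C : 𝓞 K), b 1 - k}) = s.natAbs * C.natAbs := by
  rw [map_mul, absNorm_span_pair_eq b hb hω hC₁,
    absNorm_span_pair_eq b hb hω (A := C) (C := A) (by rw [← hn]; ring)]

/-! ### The sublattice `𝔰𝔟_C` in coordinates -/

include hb hω in
/-- **`xC + y(ω − k) ∈ 𝔰·(C, ω − k) ⟺ s ∣ 2Cx − By ∧ s ∣ 2Ay − Bx`** (`B = 2k − t`), for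
`𝔰 = (s, ω − k₁)` as in `genusIdeal_mul_self` with `s` odd, and `C ≠ 0`: in the coordinates of
`𝔟_C = (C, ω − k) ≅ ℤ²` the ideal `𝔰𝔟_C` is the lattice `{v : M̃v ≡ 0 (mod s)}`, `M̃` the Hessian of
`Q̃ = (C, −B, A)`. Proof: `α ∈ 𝔰𝔟_C ⟺ 𝔰·(α) ≤ 𝔰²𝔟_C = s𝔟_C ⟺ (ω − k₁)α ∈ s𝔟_C`, and
`(ω − k₁)(xC + y(ω − k)) = (x(k − k₁) − yA)C + (xC + y(t − k − k₁))(ω − k)`; multiply the two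
coordinate congruences by `2` (invertible mod `s`) and use `2k₁ ≡ t`.
[cite: Cox2013, §7.B Thm. 7.7] -/
theorem mem_genusIdeal_mul_formIdeal_iff {s k₁ C₁ A k C : ℤ} (hodd : Odd s)
    (hk₁ : s ∣ 2 * k₁ - t) (hC₁ : s * C₁ = k₁ ^ 2 - t * k₁ - m) (hcop : IsCoprime s C₁)
    (hn : A * C = k ^ 2 - t * k - m) (hC : C ≠ 0) (x y : ℤ) :
    (x : 𝓞 K) * C + (y : 𝓞 K) * (b 1 - k) ∈
        span {(s : 𝓞 K), b 1 - k₁} * span {(C : 𝓞 K), b 1 - k} ↔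
      s ∣ 2 * C * x - (2 * k - t) * y ∧ s ∣ 2 * A * y - (2 * k - t) * x := by
  classical
  have hs0 : s ≠ 0 := by rintro rfl; exact (Int.not_even_iff_odd.mpr hodd) (by decide)
  set 𝔰 : Ideal (𝓞 K) := span {(s : 𝓞 K), b 1 - k₁} with h𝔰
  set 𝔟 : Ideal (𝓞 K) := span {(C : 𝓞 K), b 1 - k} with h𝔟
  set α : 𝓞 K := (x : 𝓞 K) * C + (y : 𝓞 K) * (b 1 - k) with hα
  have h𝔰0 : 𝔰 ≠ 0 := by
    intro h0
    have hmem : (s : 𝓞 K) ∈ 𝔰 := Ideal.subset_span (by simp)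
    rw [h0] at hmem
    have h1 : ((s : ℤ) : 𝓞 K) = 0 := by simpa using hmem
    exact hs0 (intCast_eq_zero_of_basis b hb h1)
  have hsq : 𝔰 * 𝔰 = span {(s : 𝓞 K)} := genusIdeal_mul_self b hω hk₁ hC₁ hcop
  -- step 1: `α ∈ 𝔰𝔟 ⟺ 𝔰 (α) ≤ s 𝔟`
  have step1 : α ∈ 𝔰 * 𝔟 ↔ 𝔰 * span {α} ≤ span {(s : 𝓞 K)} * 𝔟 := by
    rw [← hsq, mul_assoc, ← Ideal.span_singleton_le_iff_mem, ← Ideal.dvd_iff_le,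
      ← Ideal.dvd_iff_le, mul_dvd_mul_iff_left h𝔰0]
  -- step 2: `𝔰 (α) = (sα, (ω − k₁)α)` and `sα ∈ s𝔟` automatically
  have hαmem : α ∈ 𝔟 := (mem_span_pair_iff_of_basis b hb hω (A := C) (C := A)
    (by rw [← hn]; ring) α).2 ⟨x, y, rfl⟩
  have step2 : 𝔰 * span {α} ≤ span {(s : 𝓞 K)} * 𝔟 ↔ (b 1 - k₁) * α ∈ span {(s : 𝓞 K)} * 𝔟 := by
    rw [Ideal.mul_le]
    constructor
    · intro h
      exact h _ (Ideal.subset_span (by simp)) _ (Ideal.mem_span_singleton_self α)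
    · intro h r hr z hz
      obtain ⟨r₁, r₂, rfl⟩ := Ideal.mem_span_pair.mp hr
      obtain ⟨c, rfl⟩ := Ideal.mem_span_singleton'.mp hz
      have e : (r₁ * (s : 𝓞 K) + r₂ * (b 1 - k₁)) * (c * α) =
          (r₁ * c) * ((s : 𝓞 K) * α) + (r₂ * c) * ((b 1 - k₁) * α) := by ring
      rw [e]
      exact Ideal.add_mem _ (Ideal.mul_mem_left _ _
        (Ideal.mul_mem_mul (Ideal.mem_span_singleton_self _) hαmem)) (Ideal.mul_mem_left _ _ h)
  -- step 3: coordinates of `(ω − k₁)α` in the basis `(C, ω − k)`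
  have hAC : (b 1 - k) * (b 1 - k) = ((t : 𝓞 K) - 2 * k) * (b 1 - k) - (A : 𝓞 K) * C := by
    have e : ((A : 𝓞 K)) * C = ((k ^ 2 - t * k - m : ℤ) : 𝓞 K) := by rw [← hn]; push_cast; ring
    rw [e]; push_cast
    linear_combination hω
  have hcoord : (b 1 - k₁) * α =
      (((x * (k - k₁) - y * A : ℤ)) : 𝓞 K) * C + (((x * C + y * (t - k - k₁) : ℤ)) : 𝓞 K) * (b 1 - k) := by
    rw [hα]; push_cast
    linear_combination (y : 𝓞 K) * hAC
  have step3 : (b 1 - k₁) * α ∈ span {(s : 𝓞 K)} * 𝔟 ↔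
      s ∣ x * (k - k₁) - y * A ∧ s ∣ x * C + y * (t - k - k₁) := by
    rw [hcoord, mem_span_singleton_mul]
    constructor
    · rintro ⟨z, hz, hsz⟩
      obtain ⟨u, v, rfl⟩ := (mem_span_pair_iff_of_basis b hb hω (A := C) (C := A)
        (by rw [← hn]; ring) z).1 hz
      have e : (((s * u : ℤ)) : 𝓞 K) * C + (((s * v : ℤ)) : 𝓞 K) * (b 1 - k) =
          (((x * (k - k₁) - y * A : ℤ)) : 𝓞 K) * C +
            (((x * C + y * (t - k - k₁) : ℤ)) : 𝓞 K) * (b 1 - k) := by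
        rw [← hsz]; push_cast; ring
      obtain ⟨e1, e2⟩ := lattice_coords_unique b hb hC e
      exact ⟨⟨u, by linarith⟩, ⟨v, by linarith⟩⟩
    · rintro ⟨⟨u, hu⟩, ⟨v, hv⟩⟩
      refine ⟨(u : 𝓞 K) * C + (v : 𝓞 K) * (b 1 - k),
        (mem_span_pair_iff_of_basis b hb hω (A := C) (C := A) (by rw [← hn]; ring) _).2 ⟨u, v, rfl⟩, ?_⟩
      rw [hu, hv]; push_cast; ring
  rw [step1, step2, step3]
  -- step 4: multiply by `2` (invertible mod `s`) and use `2k₁ ≡ t (mod s)`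
  obtain ⟨j, hj⟩ := hk₁
  have h2 : IsCoprime (2 : ℤ) s := by
    obtain ⟨r, hr⟩ := hodd
    refine ⟨-r, 1, ?_⟩
    rw [hr]; ring
  constructor
  · rintro ⟨⟨u, hu⟩, ⟨v, hv⟩⟩
    refine ⟨⟨2 * v + y * j, ?_⟩, ⟨-(2 * u) - x * j, ?_⟩⟩
    · linear_combination 2 * hv + y * hj
    · linear_combination -(2 * hu) - x * hj
  · rintro ⟨h₁, h₂⟩
    constructor
    · -- `2 (x(k−k₁) − yA) = −(2Ay − Bx) − x(2k₁ − t)`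
      have h' : s ∣ 2 * (x * (k - k₁) - y * A) := by
        have e : 2 * (x * (k - k₁) - y * A) = -(2 * A * y - (2 * k - t) * x) - x * (2 * k₁ - t) := by
          ring
        rw [e]
        exact (dvd_neg.mpr h₂).sub (Dvd.dvd.mul_left ⟨j, hj⟩ x)
      exact h2.symm.dvd_of_dvd_mul_left h'
    · have h' : s ∣ 2 * (x * C + y * (t - k - k₁)) := by
        have e : 2 * (x * C + y * (t - k - k₁)) = (2 * C * x - (2 * k - t) * y) - y * (2 * k₁ - t) := by
          ring
        rw [e]
        exact h₁.sub (Dvd.dvd.mul_left ⟨j, hj⟩ y)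
      exact h2.symm.dvd_of_dvd_mul_left h'

/-! ### The `L_s`-lattice sum as a sum over the ideal `𝔰𝔟_C`, and its class sum -/

include hb hω in
/-- **`L_s ≅ 𝔰𝔟_C`**: the map `v ↦ v₁C + v₂(ω − k)` is a bijection from
`L_s = {v ∈ ℤ² : s ∣ 2Cv₁ − Bv₂, s ∣ 2Av₂ − Bv₁}` (`B = 2k − t`) onto the ideal `𝔰·(C, ω − k)`
(`mem_genusIdeal_mul_formIdeal_iff`, and `(C, ω − k) = ℤC ⊕ ℤ(ω − k)`). [cite: Cox2013, §7.B Thm. 7.7] -/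
theorem genusSublattice_bijective {s k₁ C₁ A k C : ℤ} (hodd : Odd s)
    (hk₁ : s ∣ 2 * k₁ - t) (hC₁ : s * C₁ = k₁ ^ 2 - t * k₁ - m) (hcop : IsCoprime s C₁)
    (hn : A * C = k ^ 2 - t * k - m) (hC : C ≠ 0) :
    Function.Bijective (fun v : {v : ℤ × ℤ // s ∣ 2 * C * v.1 - (2 * k - t) * v.2 ∧
        s ∣ 2 * A * v.2 - (2 * k - t) * v.1} =>
      (⟨(v.1.1 : 𝓞 K) * C + (v.1.2 : 𝓞 K) * (b 1 - k),
        (mem_genusIdeal_mul_formIdeal_iff b hb hω hodd hk₁ hC₁ hcop hn hC v.1.1 v.1.2).2 v.2⟩ :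
        ↥(span {(s : 𝓞 K), b 1 - k₁} * span {(C : 𝓞 K), b 1 - k}))) := by
  constructor
  · intro v w hvw
    have h := congrArg Subtype.val hvw
    simp only at h
    obtain ⟨h1, h2⟩ := lattice_coords_unique b hb hC h
    exact Subtype.ext (Prod.ext h1 h2)
  · rintro ⟨α, hα⟩
    have hα' : α ∈ span {(C : 𝓞 K), b 1 - k} := Ideal.mul_le_left hα
    obtain ⟨x, y, rfl⟩ := (mem_span_pair_iff_of_basis b hb hω (A := C) (C := A)
      (by rw [← hn]; ring) α).1 hα'
    exact ⟨⟨(x, y), (mem_genusIdeal_mul_formIdeal_iff b hb hω hodd hk₁ hC₁ hcop hn hC x y).1 hα⟩,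
      rfl⟩

include hb hω in
/-- Along `L_s ≅ 𝔰𝔟_C` the weight `F(|Q̃(v)|/|s|)` becomes `F(|N(α)|/N(𝔰𝔟_C))`
(`N(v₁C + v₂(ω − k)) = C·Q̃(v)`, `N(𝔰𝔟_C) = |s|·|C|`); pointwise form. [cite: Cox2013, §7.B Thm. 7.7] -/
theorem weight_genusSublattice_eq {s k₁ C₁ A k C : ℤ}
    (hC₁ : s * C₁ = k₁ ^ 2 - t * k₁ - m) (hn : A * C = k ^ 2 - t * k - m) (hC : C ≠ 0)
    (F : ℕ → ℂ) (x y : ℤ) :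
    F ((C * x ^ 2 + (t - 2 * k) * x * y + A * y ^ 2).natAbs / s.natAbs) =
      F ((Algebra.norm ℤ ((x : 𝓞 K) * C + (y : 𝓞 K) * (b 1 - k))).natAbs /
        absNorm (span {(s : 𝓞 K), b 1 - k₁} * span {(C : 𝓞 K), b 1 - k})) := by
  rw [norm_formLattice_elt_swap b hb hω hn, absNorm_genusIdeal_mul_formIdeal b hb hω hC₁ hn,
    Int.natAbs_mul, mul_comm s.natAbs C.natAbs, Nat.mul_div_mul_left _ _ (Int.natAbs_pos.mpr hC)]

include hb hω in
/-- **The `L_s`-theta series is the lattice sum of the ideal `𝔰𝔟_C`**: for any `F : ℕ → ℂ`,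
`Σ'_{v ∈ L_s} F(|Q̃(v)|/|s|) = Σ'_{α ∈ 𝔰𝔟_C} F(|N(α)|/N(𝔰𝔟_C))`
(`Q̃ = (C, t − 2k, A) = (C, −B, A)`; the bijection `genusSublattice_bijective`).
[cite: Cox2013, §7.B Thm. 7.7] -/
theorem tsum_genusSublattice_eq_tsum_ideal {s k₁ C₁ A k C : ℤ} (hodd : Odd s)
    (hk₁ : s ∣ 2 * k₁ - t) (hC₁ : s * C₁ = k₁ ^ 2 - t * k₁ - m) (hcop : IsCoprime s C₁)
    (hn : A * C = k ^ 2 - t * k - m) (hC : C ≠ 0) (F : ℕ → ℂ) :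
    (∑' v : {v : ℤ × ℤ // s ∣ 2 * C * v.1 - (2 * k - t) * v.2 ∧ s ∣ 2 * A * v.2 - (2 * k - t) * v.1},
        F ((C * v.1.1 ^ 2 + (t - 2 * k) * v.1.1 * v.1.2 + A * v.1.2 ^ 2).natAbs / s.natAbs)) =
      ∑' α : ↥(span {(s : 𝓞 K), b 1 - k₁} * span {(C : 𝓞 K), b 1 - k}),
        F ((Algebra.norm ℤ (α : 𝓞 K)).natAbs /
          absNorm (span {(s : 𝓞 K), b 1 - k₁} * span {(C : 𝓞 K), b 1 - k})) := by
  rw [← (Equiv.ofBijective _ (genusSublattice_bijective b hb hω hodd hk₁ hC₁ hcop hn hC)).tsum_eq]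
  exact tsum_congr fun v => weight_genusSublattice_eq b hb hω hC₁ hn hC F v.1.1 v.1.2

include hb hω in
/-- **The class sum carried by the `L_s`-lattice**: for an imaginary quadratic field with
`d_K < −4`, and any weight `f` with `f 0 = 0` absolutely summable over `L_s`,
`Σ_{𝔞 : 𝔰𝔟_C𝔞 principal} f(N𝔞) = ½ Σ'_{v ∈ L_s} f(|Q̃(v)|/|s|)` — the lattice sum over
`L_s = {M̃v ≡ 0 (s)}` with the form `Q̃/s` is twice the class sum of `[𝔰𝔟_C]⁻¹ = [𝔰][𝔟_A]`
(`hasSum_ideal_mul_isPrincipal_weight_of_ideal` along `genusSublattice_bijective`).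
[cite: Cox2013, §7.B Thm. 7.7] -/
theorem hasSum_ideal_genusSublattice_weight (h2 : finrank ℚ K = 2)
    (hd : NumberField.discr K < -4) {s k₁ C₁ A k C : ℤ} (hodd : Odd s)
    (hk₁ : s ∣ 2 * k₁ - t) (hC₁ : s * C₁ = k₁ ^ 2 - t * k₁ - m) (hcop : IsCoprime s C₁)
    (hn : A * C = k ^ 2 - t * k - m) (hC : C ≠ 0) {f : ℕ → ℂ} (hf0 : f 0 = 0)
    (hf : Summable fun v : {v : ℤ × ℤ // s ∣ 2 * C * v.1 - (2 * k - t) * v.2 ∧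
        s ∣ 2 * A * v.2 - (2 * k - t) * v.1} =>
      f ((C * v.1.1 ^ 2 + (t - 2 * k) * v.1.1 * v.1.2 + A * v.1.2 ^ 2).natAbs / s.natAbs)) :
    HasSum (fun J : {J : Ideal (𝓞 K) //
        (span {(s : 𝓞 K), b 1 - k₁} * span {(C : 𝓞 K), b 1 - k} * J).IsPrincipal} =>
        f (absNorm J.1))
      (1 / 2 * ∑' v : {v : ℤ × ℤ // s ∣ 2 * C * v.1 - (2 * k - t) * v.2 ∧
          s ∣ 2 * A * v.2 - (2 * k - t) * v.1},
        f ((C * v.1.1 ^ 2 + (t - 2 * k) * v.1.1 * v.1.2 + A * v.1.2 ^ 2).natAbs / s.natAbs)) := by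
  classical
  have hs0 : s ≠ 0 := by rintro rfl; exact (Int.not_even_iff_odd.mpr hodd) (by decide)
  have h𝔠0 : span {(s : 𝓞 K), b 1 - k₁} * span {(C : 𝓞 K), b 1 - k} ≠ ⊥ := by
    refine mul_ne_zero ?_ ?_
    · intro h0
      have hmem : (s : 𝓞 K) ∈ span {(s : 𝓞 K), b 1 - k₁} := Ideal.subset_span (by simp)
      rw [h0] at hmem
      exact hs0 (intCast_eq_zero_of_basis b hb (by simpa using hmem))
    · intro h0
      have hmem : (C : 𝓞 K) ∈ span {(C : 𝓞 K), b 1 - k} := Ideal.subset_span (by simp)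
      rw [h0] at hmem
      exact hC (intCast_eq_zero_of_basis b hb (by simpa using hmem))
  rw [tsum_genusSublattice_eq_tsum_ideal b hb hω hodd hk₁ hC₁ hcop hn hC f]
  refine hasSum_ideal_mul_isPrincipal_weight_of_ideal h2 hd h𝔠0 hf0 ?_
  have heq : (fun v : {v : ℤ × ℤ // s ∣ 2 * C * v.1 - (2 * k - t) * v.2 ∧
      s ∣ 2 * A * v.2 - (2 * k - t) * v.1} =>
      f ((C * v.1.1 ^ 2 + (t - 2 * k) * v.1.1 * v.1.2 + A * v.1.2 ^ 2).natAbs / s.natAbs)) =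
      (fun α : ↥(span {(s : 𝓞 K), b 1 - k₁} * span {(C : 𝓞 K), b 1 - k}) =>
        f ((Algebra.norm ℤ (α : 𝓞 K)).natAbs /
          absNorm (span {(s : 𝓞 K), b 1 - k₁} * span {(C : 𝓞 K), b 1 - k}))) ∘
        (Equiv.ofBijective _ (genusSublattice_bijective b hb hω hodd hk₁ hC₁ hcop hn hC)) := by
    funext v
    simp only [Function.comp_apply, Equiv.ofBijective_apply]
    exact weight_genusSublattice_eq b hb hω hC₁ hn hC f v.1.1 v.1.2
  rw [heq] at hf
  exact (Equiv.summable_iff _).1 hf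

/-! ### Class-group character values: `ν(𝔰𝔟_C)·ν(𝔟_A) = ν(𝔰)`, `ν(𝔰)² = 1` -/

/-- `ν_ψ(𝔞) = 1` for a nonzero principal ideal (trivial class); private. [folklore] -/
private theorem classGroupCharIdealHom_of_isPrincipal
    (ψ : ClassGroup (𝓞 K) →* ℂˣ) {I : Ideal (𝓞 K)} (hI : I ≠ ⊥) (hP : I.IsPrincipal) :
    Literature.NumberTheory.LFunctions.NumberField.classGroupCharIdealHom ψ I = 1 := by
  rw [Literature.NumberTheory.LFunctions.NumberField.classGroupCharIdealHom_apply_of_ne_bot ψ hI,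
    (ClassGroup.mk0_eq_one_iff (mem_nonZeroDivisors_of_ne_zero hI)).mpr hP, map_one, Units.val_one]

include hb hω in
/-- **`ν_ψ(𝔰)² = 1`** for every class group character (`𝔰² = (s)` is principal): the class of `𝔰`
is ambiguous. [cite: Cox2013, §7.B Thm. 7.7] -/
theorem classGroupCharIdealHom_genusIdeal_sq {s k₁ C₁ : ℤ} (hs : s ≠ 0) (hk₁ : s ∣ 2 * k₁ - t)
    (hC₁ : s * C₁ = k₁ ^ 2 - t * k₁ - m) (hcop : IsCoprime s C₁)
    (ψ : ClassGroup (𝓞 K) →* ℂˣ) :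
    Literature.NumberTheory.LFunctions.NumberField.classGroupCharIdealHom ψ
        (span {(s : 𝓞 K), b 1 - k₁}) ^ 2 = 1 := by
  rw [sq, ← map_mul, genusIdeal_mul_self b hω hk₁ hC₁ hcop]
  refine classGroupCharIdealHom_of_isPrincipal ψ ?_ ⟨⟨(s : 𝓞 K), rfl⟩⟩
  rw [Ne, Ideal.span_singleton_eq_bot]
  exact fun h => hs (intCast_eq_zero_of_basis b hb h)

include hω in
/-- **`ν_ψ(𝔰𝔟_C)·ν_ψ(𝔟_A) = ν_ψ(𝔰)`** (`𝔟_A𝔟_C = (ω − k)` is principal): the class of the dual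
lattice `𝔰𝔟_C` is `[𝔰]·[𝔟_A]⁻¹`, i.e. on the ideals of the class `[𝔰𝔟_C]⁻¹` every class group
character takes the value `ν_ψ(𝔰)·ν_ψ(𝔟_A)` (`ν_ψ(𝔰) = ±1`). [cite: Cox2013, §7.B Thm. 7.7, (7.12)] -/
theorem classGroupCharIdealHom_genusIdeal_mul_formIdeal {s k₁ A k C : ℤ}
    (hn : A * C = k ^ 2 - t * k - m) (hprim : ∃ u v w : ℤ, u * A + v * (2 * k - t) + w * C = 1)
    (hk : b 1 - (k : 𝓞 K) ≠ 0) (ψ : ClassGroup (𝓞 K) →* ℂˣ) :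
    Literature.NumberTheory.LFunctions.NumberField.classGroupCharIdealHom ψ
        (span {(s : 𝓞 K), b 1 - k₁} * span {(C : 𝓞 K), b 1 - k}) *
      Literature.NumberTheory.LFunctions.NumberField.classGroupCharIdealHom ψ
        (span {(A : 𝓞 K), b 1 - k}) =
      Literature.NumberTheory.LFunctions.NumberField.classGroupCharIdealHom ψ
        (span {(s : 𝓞 K), b 1 - k₁}) := by
  rw [← map_mul, mul_assoc, mul_comm (span {(C : 𝓞 K), b 1 - k}),
    formIdeal_mul_formIdeal_swap b hω hn hprim, map_mul,
    classGroupCharIdealHom_of_isPrincipal ψ ?_ ⟨⟨b 1 - (k : 𝓞 K), rfl⟩⟩, mul_one]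
  rw [Ne, Ideal.span_singleton_eq_bot]
  exact hk

end Literature.NumberTheory.QuadraticFields.Quadratic

end
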